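import Summits.Ventures.Crystal3D.Theorems.StickyWulffConstantCoaxialWallLawWordNoGlideMirror
import HarnessLib

/-!
# Word rigidity ACROSS root families: a menu chain is determined by its slot dozen up to the signs of its letters

HONEST FRAMING. Part of the venture `Summits/Ventures/Crystal3D` (cell `crystal3d-full`), helper for the crux
`CoaxialWallLaw` (stmt-Ventures-19481) of `route-Ventures-StickyWulffConstant`, REGISTERED line `WallLedgerF`
(planner cf-p1), open stub `stub_coaxialTwoSlabAdhesion` (general fillings).  Rung credit only; F-C1 not moved.
Brick (B1) of memo HOME/wall-19481-p2/F-MULTISOURCE.md (19481-p2 g4): the line-A word automaton is run today from ONE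
root slot; sourcing ALL rising root slots (and both plates) multiplies the flux by up to `4` while the census-free end
charging (`card_reached_ends_le_card_contacts`, a capacity bound on balls) stays the same — PROVIDED end states of different
root families at one ball have distinct predecessor balls.  That needs word rigidity BETWEEN families.  Words of different
root families are well formed for different direction functions `u`, so `word_eq_of_image_eq` (`…WordRigidity`, one family)
does not apply; and letter-wise rigidity is false across families (`[μ]` and `[−μ]` have the same frame).  What IS true,
and all that the multi-root accounting needs, is rigidity of the FRAME MAP and of the LENGTH:

* `foldl_reflect_eq_of_glued_mapsTo` — the core: two MENU CHAINS `α, α′` (unit model `{111}` normals, consecutive letters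
  at `⟪·,·⟫ = ±1/3` — the only structure `foldl_reflect_slots_false` of `…ModelChain` uses, and implied by well-formedness
  for ANY root, `word_letters_of_wf`) whose glued mirror chain `α ++ α′.reverse` maps the slots into the slots have the
  same length and the same composite mirror map.  Proof: peel the deepest letters; if they are equal or antipodal the two
  mirrors cancel in the glued chain (induction), otherwise the glued list is a nonempty menu chain — impossible by the
  3-adic non-return `foldl_reflect_slots_false`.
* `word_frame_eq_of_image_eq_of_chain` — two menu-chain words with the same slot dozen have the same length and the same
  frame AS A MAP (`F κ x = F κ′ x` for all `x`); `word_frame_eq_of_triangle_of_chain` — the `60°`-triangle form.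
* `word_frame_eq_cons_of_image_eq_mirror` — if the slot dozen of `κ′` is the dozen of `κ` mirrored across a unit menu
  normal `F κ μ`, then `F κ′ = F κ ∘ R_μ` as maps and the lengths of `κ, κ′` have opposite parity (the mirrored class of
  ANOTHER family exists as a frame; only its parity and map are pinned).

No well-formedness, no direction function: the statements are about letter lists, so they serve every root family at
once (bottom roots `w`, and — through a trailing letter `ν` — the top plate's families of a twin pair).

WHAT THIS IS NOT: not the stub; LEMMA X (distinct predecessors across families) and the multi-root instance are the next
bricks (B2, B3); F-C1 not moved.
-/

noncomputable section

namespace Summit.Ventures.Crystal3D.Theorems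

open Summit.Ventures.Crystal3D Finset
open scoped InnerProductSpace

section Multi

variable {F : List (EuclideanSpace ℝ (Fin 3)) → (EuclideanSpace ℝ (Fin 3) ≃ₗᵢ[ℝ] EuclideanSpace ℝ (Fin 3))}

/-- A mirror across `−μ` is the mirror across `μ`. -/
theorem reflect_neg_eq (x μ : EuclideanSpace ℝ (Fin 3)) :
    x - (2 * ⟪x, -μ⟫_ℝ) • (-μ) = x - (2 * ⟪x, μ⟫_ℝ) • μ := by
  rw [inner_neg_right, smul_neg, mul_neg, neg_smul, neg_neg]

/-- `foldl` of the mirror chain over `l ++ [a]`: the last letter acts last. -/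
theorem foldl_reflect_concat (l : List (EuclideanSpace ℝ (Fin 3))) (a x : EuclideanSpace ℝ (Fin 3)) :
    (l ++ [a]).foldl (fun (y : EuclideanSpace ℝ (Fin 3)) μ => y - (2 * ⟪y, μ⟫_ℝ) • μ) x =
      (l.foldl (fun (y : EuclideanSpace ℝ (Fin 3)) μ => y - (2 * ⟪y, μ⟫_ℝ) • μ) x) -
        (2 * ⟪l.foldl (fun (y : EuclideanSpace ℝ (Fin 3)) μ => y - (2 * ⟪y, μ⟫_ℝ) • μ) x, a⟫_ℝ) • a := by
  rw [List.foldl_append, List.foldl_cons, List.foldl_nil]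

/-- **The core of cross-family rigidity.**  Two menu chains whose glued mirror chain `α ++ α′.reverse` maps the slots
into the slots have the same length and the same composite mirror map.  See the module docstring. -/
theorem foldl_reflect_eq_of_glued_mapsTo :
    ∀ (α α' : List (EuclideanSpace ℝ (Fin 3))),
      (∀ μ ∈ α, ‖μ‖ = 1 ∧
        ∀ w ∈ fccSlots, ⟪w, μ⟫_ℝ = 0 ∨ ⟪w, μ⟫_ℝ = Real.sqrt (2 / 3) ∨ ⟪w, μ⟫_ℝ = -Real.sqrt (2 / 3)) →
      (∀ μ ∈ α', ‖μ‖ = 1 ∧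
        ∀ w ∈ fccSlots, ⟪w, μ⟫_ℝ = 0 ∨ ⟪w, μ⟫_ℝ = Real.sqrt (2 / 3) ∨ ⟪w, μ⟫_ℝ = -Real.sqrt (2 / 3)) →
      List.IsChain (fun μ μ' => ⟪μ, μ'⟫_ℝ = 1 / 3 ∨ ⟪μ, μ'⟫_ℝ = -1 / 3) α →
      List.IsChain (fun μ μ' => ⟪μ, μ'⟫_ℝ = 1 / 3 ∨ ⟪μ, μ'⟫_ℝ = -1 / 3) α' →
      (∀ w ∈ fccSlots,
        (α ++ α'.reverse).foldl (fun (y : EuclideanSpace ℝ (Fin 3)) μ => y - (2 * ⟪y, μ⟫_ℝ) • μ) w ∈ fccSlots) →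
      α.length = α'.length ∧
        ∀ x : EuclideanSpace ℝ (Fin 3),
          α.foldl (fun (y : EuclideanSpace ℝ (Fin 3)) μ => y - (2 * ⟪y, μ⟫_ℝ) • μ) x =
            α'.foldl (fun (y : EuclideanSpace ℝ (Fin 3)) μ => y - (2 * ⟪y, μ⟫_ℝ) • μ) x := by
  intro α
  induction α using List.reverseRecOn with
  | nil =>
    intro α' _ hα' _ hch' hmaps
    rcases List.eq_nil_or_concat' α' with rfl | ⟨l', a', rfl⟩
    · exact ⟨rfl, fun x => rfl⟩
    · exfalso
      refine foldl_reflect_slots_false (l' ++ [a']).reverse (by simp) ?_ ?_ ?_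
      · intro μ hμ; exact hα' μ (List.mem_reverse.1 hμ)
      · rw [List.isChain_reverse]
        exact hch'.imp fun a b h => by rw [real_inner_comm]; exact h
      · intro w hw
        simpa using hmaps w hw
  | append_singleton l a ih =>
    intro α' hα hα' hch hch' hmaps
    have ha1 : ‖a‖ = 1 := (hα a (by simp)).1
    have ham := (hα a (by simp)).2
    have hl : ∀ μ ∈ l, ‖μ‖ = 1 ∧
        ∀ w ∈ fccSlots, ⟪w, μ⟫_ℝ = 0 ∨ ⟪w, μ⟫_ℝ = Real.sqrt (2 / 3) ∨ ⟪w, μ⟫_ℝ = -Real.sqrt (2 / 3) :=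
      fun μ hμ => hα μ (List.mem_append_left _ hμ)
    have hchl : List.IsChain (fun μ μ' => ⟪μ, μ'⟫_ℝ = 1 / 3 ∨ ⟪μ, μ'⟫_ℝ = -1 / 3) l := hch.left_of_append
    rcases List.eq_nil_or_concat' α' with rfl | ⟨l', a', rfl⟩
    · -- `α' = []`: the glued list is `α` itself, a nonempty chain
      exfalso
      refine foldl_reflect_slots_false (l ++ [a]) (by simp) hα hch ?_
      intro w hw
      simpa using hmaps w hw
    · have ha'1 : ‖a'‖ = 1 := (hα' a' (by simp)).1
      have ha'm := (hα' a' (by simp)).2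
      have hl' : ∀ μ ∈ l', ‖μ‖ = 1 ∧
          ∀ w ∈ fccSlots, ⟪w, μ⟫_ℝ = 0 ∨ ⟪w, μ⟫_ℝ = Real.sqrt (2 / 3) ∨ ⟪w, μ⟫_ℝ = -Real.sqrt (2 / 3) :=
        fun μ hμ => hα' μ (List.mem_append_left _ hμ)
      have hchl' : List.IsChain (fun μ μ' => ⟪μ, μ'⟫_ℝ = 1 / 3 ∨ ⟪μ, μ'⟫_ℝ = -1 / 3) l' := hch'.left_of_append
      -- the glued list is `(l ++ [a]) ++ (a' :: l'.reverse)`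
      have hrev : (l' ++ [a']).reverse = a' :: l'.reverse := by simp
      by_cases hsign : a' = a ∨ a' = -a
      · -- the two deepest mirrors cancel: induction
        have hcancel : ∀ z : EuclideanSpace ℝ (Fin 3),
            (z - (2 * ⟪z, a⟫_ℝ) • a) - (2 * ⟪z - (2 * ⟪z, a⟫_ℝ) • a, a'⟫_ℝ) • a' = z := by
          intro z
          rcases hsign with rfl | rfl
          · exact reflect_reflect_unit ha1 z
          · rw [reflect_neg_eq]; exact reflect_reflect_unit ha1 z
        have hmaps' : ∀ w ∈ fccSlots,
            (l ++ l'.reverse).foldl (fun (y : EuclideanSpace ℝ (Fin 3)) μ => y - (2 * ⟪y, μ⟫_ℝ) • μ) w ∈ fccSlots := by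
          intro w hw
          have h1 := hmaps w hw
          rw [hrev, List.foldl_append, List.foldl_cons, foldl_reflect_concat, hcancel] at h1
          rw [List.foldl_append]; exact h1
        obtain ⟨hlen, hmap⟩ := ih l' hl hl' hchl hchl' hmaps'
        refine ⟨by simp [hlen], fun x => ?_⟩
        rw [foldl_reflect_concat, foldl_reflect_concat, hmap]
        rcases hsign with rfl | rfl
        · rfl
        · rw [reflect_neg_eq]
      · -- distinct, non-antipodal deepest letters: the glued list is a nonempty menu chain
        exfalso
        obtain ⟨hne1, hne2⟩ := not_or.1 hsign
        have hjunction : ⟪a, a'⟫_ℝ = 1 / 3 ∨ ⟪a, a'⟫_ℝ = -1 / 3 :=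
          menuNormals_chain_of_ne_of_ne_neg ha1 ha'1 ham ha'm (Ne.symm hne1) hne2
        refine foldl_reflect_slots_false ((l ++ [a]) ++ (l' ++ [a']).reverse) (by simp) ?_ ?_ hmaps
        · intro μ hμ
          rcases List.mem_append.1 hμ with h | h
          · exact hα μ h
          · exact hα' μ (List.mem_reverse.1 h)
        · rw [List.isChain_append]
          refine ⟨hch, ?_, ?_⟩
          · rw [List.isChain_reverse]
            exact hch'.imp fun a b h => by rw [real_inner_comm]; exact h
          · intro x hx y hy
            rw [hrev, List.head?_cons, Option.mem_some_iff] at hy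
            rw [List.getLast?_concat, Option.mem_some_iff] at hx
            rw [← hx, ← hy]
            exact hjunction

/-- **Cross-family word rigidity (frame map and length).**  Two menu-chain words with the same slot dozen have the same
length and the same frame as a map.  See the module docstring. -/
theorem word_frame_eq_of_image_eq_of_chain (hFc : ∀ μ κ, F (μ :: κ) = ((ℝ ∙ μ)ᗮ.reflection).trans (F κ))
    {κ κ' : List (EuclideanSpace ℝ (Fin 3))}
    (hκ : ∀ μ ∈ κ, ‖μ‖ = 1 ∧
      ∀ w ∈ fccSlots, ⟪w, μ⟫_ℝ = 0 ∨ ⟪w, μ⟫_ℝ = Real.sqrt (2 / 3) ∨ ⟪w, μ⟫_ℝ = -Real.sqrt (2 / 3))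
    (hκ' : ∀ μ ∈ κ', ‖μ‖ = 1 ∧
      ∀ w ∈ fccSlots, ⟪w, μ⟫_ℝ = 0 ∨ ⟪w, μ⟫_ℝ = Real.sqrt (2 / 3) ∨ ⟪w, μ⟫_ℝ = -Real.sqrt (2 / 3))
    (hch : List.IsChain (fun μ μ' => ⟪μ, μ'⟫_ℝ = 1 / 3 ∨ ⟪μ, μ'⟫_ℝ = -1 / 3) κ)
    (hch' : List.IsChain (fun μ μ' => ⟪μ, μ'⟫_ℝ = 1 / 3 ∨ ⟪μ, μ'⟫_ℝ = -1 / 3) κ')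
    (himg : (F κ : EuclideanSpace ℝ (Fin 3) → EuclideanSpace ℝ (Fin 3)) '' ↑fccSlots =
      (F κ' : EuclideanSpace ℝ (Fin 3) → EuclideanSpace ℝ (Fin 3)) '' ↑fccSlots) :
    κ.length = κ'.length ∧ ∀ x : EuclideanSpace ℝ (Fin 3), F κ x = F κ' x := by
  have hκu : ∀ μ ∈ κ, ‖μ‖ = 1 := fun μ hμ => (hκ μ hμ).1
  have hκ'u : ∀ μ ∈ κ', ‖μ‖ = 1 := fun μ hμ => (hκ' μ hμ).1
  have hFκ : ∀ x, F κ x = F [] (κ.foldl (fun (y : EuclideanSpace ℝ (Fin 3)) μ => y - (2 * ⟪y, μ⟫_ℝ) • μ) x) := by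
    intro x
    have := word_F_append_apply hFc κ hκu [] x
    rwa [List.append_nil] at this
  have hFκ' : ∀ x, F κ' x = F [] (κ'.foldl (fun (y : EuclideanSpace ℝ (Fin 3)) μ => y - (2 * ⟪y, μ⟫_ℝ) • μ) x) := by
    intro x
    have := word_F_append_apply hFc κ' hκ'u [] x
    rwa [List.append_nil] at this
  have hmaps : ∀ w ∈ fccSlots,
      (κ ++ κ'.reverse).foldl (fun (y : EuclideanSpace ℝ (Fin 3)) μ => y - (2 * ⟪y, μ⟫_ℝ) • μ) w ∈ fccSlots := by
    intro w hw
    have hmem : (F κ : EuclideanSpace ℝ (Fin 3) → EuclideanSpace ℝ (Fin 3)) w ∈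
        (F κ' : EuclideanSpace ℝ (Fin 3) → EuclideanSpace ℝ (Fin 3)) '' ↑fccSlots := by
      rw [← himg]; exact Set.mem_image_of_mem _ (Finset.mem_coe.2 hw)
    obtain ⟨w', hw', heq⟩ := hmem
    rw [Finset.mem_coe] at hw'
    have heq' : κ'.foldl (fun (y : EuclideanSpace ℝ (Fin 3)) μ => y - (2 * ⟪y, μ⟫_ℝ) • μ) w' =
        κ.foldl (fun (y : EuclideanSpace ℝ (Fin 3)) μ => y - (2 * ⟪y, μ⟫_ℝ) • μ) w := by
      apply (F []).injective
      rw [← hFκ, ← hFκ']; exact heq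
    have key := foldl_reflect_reverse_foldl κ' hκ'u w'
    rw [heq', ← List.foldl_append] at key
    rw [key]; exact hw'
  obtain ⟨hlen, hmap⟩ := foldl_reflect_eq_of_glued_mapsTo κ κ' hκ hκ' hch hch' hmaps
  exact ⟨hlen, fun x => by rw [hFκ, hFκ', hmap]⟩

/-- **Cross-family word rigidity, triangle form.**  If a `60°` triangle of `F κ`-slots lies in the slot dozen of
`F κ′` for menu-chain words `κ, κ′`, then they have the same length and the same frame map. -/
theorem word_frame_eq_of_triangle_of_chain (hFc : ∀ μ κ, F (μ :: κ) = ((ℝ ∙ μ)ᗮ.reflection).trans (F κ))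
    {κ κ' : List (EuclideanSpace ℝ (Fin 3))}
    (hκ : ∀ μ ∈ κ, ‖μ‖ = 1 ∧
      ∀ w ∈ fccSlots, ⟪w, μ⟫_ℝ = 0 ∨ ⟪w, μ⟫_ℝ = Real.sqrt (2 / 3) ∨ ⟪w, μ⟫_ℝ = -Real.sqrt (2 / 3))
    (hκ' : ∀ μ ∈ κ', ‖μ‖ = 1 ∧
      ∀ w ∈ fccSlots, ⟪w, μ⟫_ℝ = 0 ∨ ⟪w, μ⟫_ℝ = Real.sqrt (2 / 3) ∨ ⟪w, μ⟫_ℝ = -Real.sqrt (2 / 3))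
    (hch : List.IsChain (fun μ μ' => ⟪μ, μ'⟫_ℝ = 1 / 3 ∨ ⟪μ, μ'⟫_ℝ = -1 / 3) κ)
    (hch' : List.IsChain (fun μ μ' => ⟪μ, μ'⟫_ℝ = 1 / 3 ∨ ⟪μ, μ'⟫_ℝ = -1 / 3) κ')
    (htri : ∃ a ∈ fccSlots, ∃ a' ∈ fccSlots, ∃ a'' ∈ fccSlots,
        ⟪a, a'⟫_ℝ = 1 / 2 ∧ ⟪a, a''⟫_ℝ = 1 / 2 ∧ ⟪a', a''⟫_ℝ = 1 / 2 ∧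
        (∃ w ∈ fccSlots, F κ' w = F κ a) ∧ (∃ w ∈ fccSlots, F κ' w = F κ a') ∧
        (∃ w ∈ fccSlots, F κ' w = F κ a'')) :
    κ.length = κ'.length ∧ ∀ x : EuclideanSpace ℝ (Fin 3), F κ x = F κ' x := by
  obtain ⟨a, ha, a', ha', a'', ha'', i1, i2, i3, ⟨w₁, hw₁, e₁⟩, ⟨w₂, hw₂, e₂⟩, ⟨w₃, hw₃, e₃⟩⟩ := htri
  refine word_frame_eq_of_image_eq_of_chain hFc hκ hκ' hch hch' ?_
  exact image_fccSlots_eq_of_triangle (F κ) (F κ') ha ha' ha'' i1 i2 i3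
    ⟨w₁, Finset.mem_coe.2 hw₁, e₁⟩ ⟨w₂, Finset.mem_coe.2 hw₂, e₂⟩ ⟨w₃, Finset.mem_coe.2 hw₃, e₃⟩

/-- **Cross-family rigidity, mirrored form.**  If the slot dozen of the menu-chain word `κ′` is the dozen of the
menu-chain word `κ` mirrored across the unit menu normal `F κ μ` (`μ` a unit model menu normal), then `F κ′ = F κ ∘ R_μ`
as maps and the lengths of `κ, κ′` have opposite parity.  See the module docstring. -/
theorem word_frame_eq_cons_of_image_eq_mirror (hFc : ∀ μ κ, F (μ :: κ) = ((ℝ ∙ μ)ᗮ.reflection).trans (F κ))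
    {κ κ' : List (EuclideanSpace ℝ (Fin 3))}
    (hκ : ∀ μ ∈ κ, ‖μ‖ = 1 ∧
      ∀ w ∈ fccSlots, ⟪w, μ⟫_ℝ = 0 ∨ ⟪w, μ⟫_ℝ = Real.sqrt (2 / 3) ∨ ⟪w, μ⟫_ℝ = -Real.sqrt (2 / 3))
    (hκ' : ∀ μ ∈ κ', ‖μ‖ = 1 ∧
      ∀ w ∈ fccSlots, ⟪w, μ⟫_ℝ = 0 ∨ ⟪w, μ⟫_ℝ = Real.sqrt (2 / 3) ∨ ⟪w, μ⟫_ℝ = -Real.sqrt (2 / 3))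
    (hch : List.IsChain (fun μ μ' => ⟪μ, μ'⟫_ℝ = 1 / 3 ∨ ⟪μ, μ'⟫_ℝ = -1 / 3) κ)
    (hch' : List.IsChain (fun μ μ' => ⟪μ, μ'⟫_ℝ = 1 / 3 ∨ ⟪μ, μ'⟫_ℝ = -1 / 3) κ')
    {μ : EuclideanSpace ℝ (Fin 3)} (hμ1 : ‖μ‖ = 1)
    (hμm : ∀ w ∈ fccSlots, ⟪w, μ⟫_ℝ = 0 ∨ ⟪w, μ⟫_ℝ = Real.sqrt (2 / 3) ∨ ⟪w, μ⟫_ℝ = -Real.sqrt (2 / 3))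
    (himg : (F κ' : EuclideanSpace ℝ (Fin 3) → EuclideanSpace ℝ (Fin 3)) '' ↑fccSlots =
      (fun x => F κ x - (2 * ⟪F κ x, F κ μ⟫_ℝ) • F κ μ) '' ↑fccSlots) :
    (κ.length + κ'.length) % 2 = 1 ∧
      ∀ x : EuclideanSpace ℝ (Fin 3), F κ' x = F κ (x - (2 * ⟪x, μ⟫_ℝ) • μ) := by
  -- the mirrored dozen is the dozen of `μ :: κ`
  have hcons : ∀ x, F (μ :: κ) x = F κ (x - (2 * ⟪x, μ⟫_ℝ) • μ) := fun x => word_F_cons_apply hFc hμ1 κ x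
  have himg' : (F κ' : EuclideanSpace ℝ (Fin 3) → EuclideanSpace ℝ (Fin 3)) '' ↑fccSlots =
      (F (μ :: κ) : EuclideanSpace ℝ (Fin 3) → EuclideanSpace ℝ (Fin 3)) '' ↑fccSlots := by
    rw [himg]
    refine Set.image_congr fun x _ => ?_
    rw [hcons, mirror_conj]
  -- either `μ :: κ` is a menu chain, or its first two mirrors cancel
  cases κ with
  | nil =>
    have hc1 : ∀ ν ∈ [μ], ‖ν‖ = 1 ∧
        ∀ w ∈ fccSlots, ⟪w, ν⟫_ℝ = 0 ∨ ⟪w, ν⟫_ℝ = Real.sqrt (2 / 3) ∨ ⟪w, ν⟫_ℝ = -Real.sqrt (2 / 3) := by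
      intro ν hν; rw [List.mem_singleton] at hν; subst hν; exact ⟨hμ1, hμm⟩
    obtain ⟨hlen, hmap⟩ := word_frame_eq_of_image_eq_of_chain hFc hκ' hc1 hch' (List.isChain_singleton μ) himg'
    refine ⟨by simp [hlen], fun x => by rw [hmap x, hcons]⟩
  | cons μ₁ κ₀ =>
    have hμ₁1 : ‖μ₁‖ = 1 := (hκ μ₁ (by simp)).1
    have hμ₁m := (hκ μ₁ (by simp)).2
    by_cases hsign : μ = μ₁ ∨ μ = -μ₁
    · -- cancellation: `F (μ :: μ₁ :: κ₀) = F κ₀` as maps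
      have hκ₀ : ∀ ν ∈ κ₀, ‖ν‖ = 1 ∧
          ∀ w ∈ fccSlots, ⟪w, ν⟫_ℝ = 0 ∨ ⟪w, ν⟫_ℝ = Real.sqrt (2 / 3) ∨ ⟪w, ν⟫_ℝ = -Real.sqrt (2 / 3) :=
        fun ν hν => hκ ν (by simp [hν])
      have hch₀ : List.IsChain (fun μ μ' => ⟪μ, μ'⟫_ℝ = 1 / 3 ∨ ⟪μ, μ'⟫_ℝ = -1 / 3) κ₀ := hch.tail
      have hcancel : ∀ x, F (μ :: μ₁ :: κ₀) x = F κ₀ x := by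
        intro x
        rw [word_F_cons_apply hFc hμ1, word_F_cons_apply hFc hμ₁1]
        rcases hsign with rfl | rfl
        · rw [reflect_reflect_unit hμ1]
        · rw [reflect_neg_eq, reflect_reflect_unit hμ₁1]
      have himg₀ : (F κ' : EuclideanSpace ℝ (Fin 3) → EuclideanSpace ℝ (Fin 3)) '' ↑fccSlots =
          (F κ₀ : EuclideanSpace ℝ (Fin 3) → EuclideanSpace ℝ (Fin 3)) '' ↑fccSlots := by
        rw [himg']; exact Set.image_congr fun x _ => hcancel x
      obtain ⟨hlen, hmap⟩ := word_frame_eq_of_image_eq_of_chain hFc hκ' hκ₀ hch' hch₀ himg₀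
      refine ⟨?_, fun x => ?_⟩
      · simp only [List.length_cons, hlen]; omega
      · rw [hmap x, ← hcancel x, word_F_cons_apply hFc hμ1]
    · -- `μ :: κ` is a menu chain
      obtain ⟨hne1, hne2⟩ := not_or.1 hsign
      have hc1 : ∀ ν ∈ μ :: μ₁ :: κ₀, ‖ν‖ = 1 ∧
          ∀ w ∈ fccSlots, ⟪w, ν⟫_ℝ = 0 ∨ ⟪w, ν⟫_ℝ = Real.sqrt (2 / 3) ∨ ⟪w, ν⟫_ℝ = -Real.sqrt (2 / 3) := by
        intro ν hν
        rcases List.mem_cons.1 hν with rfl | hν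
        · exact ⟨hμ1, hμm⟩
        · exact hκ ν hν
      have hjunction : ⟪μ, μ₁⟫_ℝ = 1 / 3 ∨ ⟪μ, μ₁⟫_ℝ = -1 / 3 :=
        menuNormals_chain_of_ne_of_ne_neg hμ1 hμ₁1 hμm hμ₁m hne1 (fun h => hne2 (by rw [h, neg_neg]))
      have hchc : List.IsChain (fun μ μ' => ⟪μ, μ'⟫_ℝ = 1 / 3 ∨ ⟪μ, μ'⟫_ℝ = -1 / 3) (μ :: μ₁ :: κ₀) :=
        hch.cons_cons hjunction
      obtain ⟨hlen, hmap⟩ := word_frame_eq_of_image_eq_of_chain hFc hκ' hc1 hch' hchc himg'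
      refine ⟨?_, fun x => by rw [hmap x, hcons]⟩
      simp only [List.length_cons] at hlen ⊢
      omega

end Multi

end Summit.Ventures.Crystal3D.Theorems

end
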